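import Mathlib.Analysis.SpecialFunctions.Pow.Deriv
import Mathlib.Analysis.Convex.SpecificFunctions.Basic
import Mathlib.Analysis.Calculus.IteratedDeriv.Lemmas
import HarnessLib

/-!
# An elementary supersolution for Rohde–Schramm's Lemma 6.3 (`κ < 8`)

Deterministic (calculus) layer of the discharge of the named fact
`Literature.Probability.RandomPlanarGeometry.exists_tendsto_sleDerivRatio_of_lt_eight`
(Rohde–Schramm, *Basic properties of SLE*, Ann. of Math. 161 (2005), **Lemma 6.3**, case `κ < 8`:
for `z₀ ∈ ℍ` the ratio `Rₜ = (Im z₀)|gₜ'(z₀)|/Im gₜ(z₀)` has a.s. a *finite* limit `Z(z₀)` as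
`t ↑ τ(z₀)`).

The printed proof (pp. 904–905) applies Itô's formula to `Mₜ = Rₜ^a Ĝ(zₜ)`, `zₜ = xₜ + i yₜ =
gₜ(z₀) - Wₜ`, where `Ĝ = Ĝ_{a,κ}` is a hypergeometric function of `w = x/y` solving the ODE (6.9)
exactly, so that `M` is a local martingale, and then needs the analytic input (6.10),
`inf Ĝ > 0` for `a` slightly below `1 - κ/8`. With `Rₜ = exp ψₜ`, `ψ̇ = 4y²/|z|⁴` ((6.4), in the tree
`Loewner.im_mul_norm_deriv_map_div_im_eq_exp`), `dx = (2x/|z|²) dt - dW`, `ẏ = -2y/|z|²`,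
`d⟨x⟩ = κ dt`, the drift of `Rₜ^a G(xₜ/yₜ)` for a `C²` function `G` of `w = x/y` is
`(Rₜ^a / yₜ²) · D_G(wₜ)` with

  `D_G(w) = 4a G(w)/(1+w²)² + 4w G'(w)/(1+w²) + (κ/2) G''(w)`

(the generator of the time-changed diffusion `w`, cf. p. 904 "`w(u) = xₜ/yₜ` is a
time-homogeneous diffusion as a function of `u = log yₜ`"). For the *finiteness* half of Lemma 6.3
an exact solution is not needed: any bounded `G ≥ 1` with `D_G ≤ 0` for *some* `a > 0` makes
`Rₜ^a G(wₜ) ≥ Rₜ^a` a non-negative local supermartingale, whence `E[Z^a] ≤ G(w₀) ≤ 2` and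
`Z < ∞` a.s. This file supplies such an **elementary supersolution** and proves the inequality:

* `rsSuperBeta κ = (8-κ)/(4(κ+2))`, `rsSuperExp κ = a = κ(8-κ)/(32(κ+2))` (so `8a = κβ`,
  `4a + 2κβ + κ - 8 ≤ 0`, and `0 < a < 1 - κ/8` for `0 < κ < 8`, inside the printed range of finite
  moments `E[Z^a] < ∞ ⇔ a < 1 - κ/8`);
* `rsSuperG κ w = 1 + (1+w²)^{-β} ∈ (1, 2]`, smooth, with its first two derivatives in closed form;
* `rsSuperDrift κ w = D_G(w)` for `G = rsSuperG κ` and `a = rsSuperExp κ`, written with Mathlib's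
  `deriv` / `iteratedDeriv 2` exactly as the drift delivered by the tree's Itô formula
  (`Literature.Analysis.FunctionSpaces.ito_formula_itoProcess_ae`), and the key estimate
  **`rsSuperDrift_nonpos : D_G(w) ≤ 0`** for `0 ≤ κ < 8` — by the identity
  `D_G(w)(1+w²)^{β+2} = 4a(1+w²)^β + (4a - κβ) + βw²(2κβ + κ - 8)` and Bernoulli's inequality
  `(1+w²)^β ≤ 1 + βw²` (`β ≤ 1`, Mathlib `rpow_one_add_le_one_add_mul_self`).

The critical exponent here is `β < (8-κ)/(2κ)`: for `β = (8-κ)/(2κ)`, `a = 1 - κ/8` one recovers the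
exact but *unbounded-below* solution `(y/|z|)^{(8-κ)/κ}` noted on p. 905, which is why a strictly
smaller `β` and the additive constant `1` are used. Nothing here is specific to SLE: the file is
pure one-variable calculus (no measure theory), consumed by the stochastic layer.

## Mathlib

We USE `Real.rpow` calculus (`HasDerivAt.rpow_const`, `ContDiff.rpow_const_of_ne`,
`Real.rpow_add`, `Real.rpow_neg`, `Real.rpow_natCast`, `Real.rpow_le_one_of_one_le_of_nonpos`),
`iteratedDeriv_succ`, and Bernoulli's inequality `rpow_one_add_le_one_add_mul_self`.

## References

* S. Rohde, O. Schramm, *Basic properties of SLE*, Ann. of Math. 161 (2005) 883–924: Lemma 6.3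
  and its proof, eqs. (6.3)–(6.5), (6.9), (6.10) (pp. 903–906).
-/

noncomputable section

open Set Real

namespace Literature.Probability.RandomPlanarGeometry

/-! ### The exponents `β(κ)` and `a(κ)` -/

/-- The decay exponent **`β(κ) = (8-κ)/(4(κ+2))`** of the supersolution `1 + (1+w²)^{-β}`; half-way
below the critical exponent `(8-κ)/(2κ)` of Rohde–Schramm's exact solution `(y/|z|)^{(8-κ)/κ}`
(p. 905), and at most `1`. A technical device (no claim of provenance). [folklore] -/
def rsSuperBeta (κ : ℝ) : ℝ :=
  (8 - κ) / (4 * (κ + 2))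

/-- The moment exponent **`a(κ) = κ(8-κ)/(32(κ+2))`** for which `Rₜ^a (1 + (1+wₜ²)^{-β})` is a
supermartingale; it lies in Rohde–Schramm's range `0 < a < 1 - κ/8` of finite moments `E[Z^a]`
(Lemma 6.3) when `0 < κ < 8`. A technical device (no claim of provenance). [folklore] -/
def rsSuperExp (κ : ℝ) : ℝ :=
  κ * (8 - κ) / (32 * (κ + 2))

section Exponents

variable {κ : ℝ}

/-- `β(κ) > 0` for `-2 < κ < 8`. [folklore] -/
theorem rsSuperBeta_pos (h2 : -2 < κ) (h8 : κ < 8) : 0 < rsSuperBeta κ := by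
  unfold rsSuperBeta
  exact div_pos (by linarith) (by linarith)

/-- `β(κ) ≥ 0` for `-2 < κ ≤ 8`. [folklore] -/
theorem rsSuperBeta_nonneg (h2 : -2 < κ) (h8 : κ ≤ 8) : 0 ≤ rsSuperBeta κ := by
  unfold rsSuperBeta
  exact div_nonneg (by linarith) (by linarith)

/-- `β(κ) ≤ 1` for `κ ≥ 0`. [folklore] -/
theorem rsSuperBeta_le_one (h0 : 0 ≤ κ) : rsSuperBeta κ ≤ 1 := by
  unfold rsSuperBeta
  rw [div_le_one (by linarith)]
  linarith

/-- `a(κ) > 0` for `0 < κ < 8`. [folklore] -/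
theorem rsSuperExp_pos (h0 : 0 < κ) (h8 : κ < 8) : 0 < rsSuperExp κ := by
  unfold rsSuperExp
  exact div_pos (mul_pos h0 (by linarith)) (by linarith)

/-- `a(κ) ≥ 0` for `0 ≤ κ ≤ 8`. [folklore] -/
theorem rsSuperExp_nonneg (h0 : 0 ≤ κ) (h8 : κ ≤ 8) : 0 ≤ rsSuperExp κ := by
  unfold rsSuperExp
  exact div_nonneg (mul_nonneg h0 (by linarith)) (by linarith)

/-- The first design identity: **`8 a(κ) = κ β(κ)`** (`κ > -2`). [folklore] -/
theorem eight_mul_rsSuperExp (h2 : -2 < κ) : 8 * rsSuperExp κ = κ * rsSuperBeta κ := by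
  unfold rsSuperExp rsSuperBeta
  have : (κ + 2) ≠ 0 := by linarith
  field_simp
  ring

/-- The second design inequality: **`4a + 2κβ + κ - 8 ≤ 0`** (`κ ≥ 0`): with `8-κ = 4β(κ+2)` it reads
`5κβ/2 ≤ 4β(κ+2)`. [folklore] -/
theorem rsSuper_ineq (h0 : 0 ≤ κ) (h8 : κ ≤ 8) :
    4 * rsSuperExp κ + 2 * κ * rsSuperBeta κ + κ - 8 ≤ 0 := by
  unfold rsSuperExp rsSuperBeta
  have hk : 0 < κ + 2 := by linarith
  rw [show 4 * (κ * (8 - κ) / (32 * (κ + 2))) + 2 * κ * ((8 - κ) / (4 * (κ + 2))) + κ - 8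
      = (8 - κ) * (5 * κ - 8 * (κ + 2)) / (8 * (κ + 2)) by field_simp; ring]
  apply div_nonpos_of_nonpos_of_nonneg _ (by linarith)
  exact mul_nonpos_of_nonneg_of_nonpos (by linarith) (by linarith)

/-- `a(κ) < 1 - κ/8` for `0 ≤ κ < 8`: the exponent lies in Rohde–Schramm's range of finite moments
`E[Z(z)^a] < ∞` (Lemma 6.3: finite iff `a < 1 - κ/8`, for `κ < 8`).
[cite: RohdeSchramm2005, Lemma 6.3] -/
theorem rsSuperExp_lt (h0 : 0 ≤ κ) (h8 : κ < 8) : rsSuperExp κ < 1 - κ / 8 := by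
  unfold rsSuperExp
  have hk : 0 < κ + 2 := by linarith
  rw [div_lt_iff₀ (by linarith)]
  nlinarith

end Exponents

/-! ### The supersolution `G(w) = 1 + (1 + w²)^{-β}` -/

/-- The **elementary supersolution** `G(w) = 1 + (1 + w²)^{-β(κ)}` of Rohde–Schramm's generator
inequality `D_G ≤ 0` (replacing the hypergeometric `Ĝ_{a,κ}` of Lemma 6.3, p. 903, for the
finiteness half of the lemma). [folklore] -/
def rsSuperG (κ w : ℝ) : ℝ :=
  1 + (1 + w ^ 2) ^ (-rsSuperBeta κ)

section SuperG

variable (κ : ℝ) {w : ℝ}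

/-- `1 + w² > 0`. [folklore] -/
theorem one_add_sq_pos' (w : ℝ) : 0 < 1 + w ^ 2 := by positivity

/-- Unfolding of `rsSuperG`. [folklore] -/
theorem rsSuperG_apply (w : ℝ) : rsSuperG κ w = 1 + (1 + w ^ 2) ^ (-rsSuperBeta κ) := rfl

/-- `G > 1`. [folklore] -/
theorem one_lt_rsSuperG (w : ℝ) : 1 < rsSuperG κ w := by
  rw [rsSuperG_apply]
  exact lt_add_of_pos_right _ (rpow_pos_of_pos (one_add_sq_pos' w) _)

/-- `G > 0`. [folklore] -/
theorem rsSuperG_pos (w : ℝ) : 0 < rsSuperG κ w :=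
  one_pos.trans (one_lt_rsSuperG κ w)

variable {κ}

/-- `G ≤ 2` when `β ≥ 0` (`-2 < κ ≤ 8`): `(1+w²)^{-β} ≤ 1`. [folklore] -/
theorem rsSuperG_le_two (h2 : -2 < κ) (h8 : κ ≤ 8) (w : ℝ) : rsSuperG κ w ≤ 2 := by
  rw [rsSuperG_apply]
  have h1 : (1 : ℝ) ≤ 1 + w ^ 2 := by nlinarith
  have := rpow_le_one_of_one_le_of_nonpos h1 (neg_nonpos.2 (rsSuperBeta_nonneg h2 h8))
  linarith

variable (κ)

/-- **First derivative**: `G'(w) = -2βw (1+w²)^{-β-1}`. [folklore] -/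
theorem hasDerivAt_rsSuperG (w : ℝ) :
    HasDerivAt (rsSuperG κ) (-2 * rsSuperBeta κ * w * (1 + w ^ 2) ^ (-rsSuperBeta κ - 1)) w := by
  have hu : HasDerivAt (fun w : ℝ ↦ 1 + w ^ 2) (2 * w) w := by
    simpa using (hasDerivAt_pow 2 w).const_add 1
  have h : HasDerivAt (fun w : ℝ ↦ 1 + (1 + w ^ 2) ^ (-rsSuperBeta κ))
      (2 * w * (-rsSuperBeta κ) * (1 + w ^ 2) ^ (-rsSuperBeta κ - 1)) w :=
    (hu.rpow_const (p := -rsSuperBeta κ) (Or.inl (one_add_sq_pos' w).ne')).const_add 1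
  exact h.congr_deriv (by ring)

/-- `deriv G w = -2βw (1+w²)^{-β-1}`. [folklore] -/
theorem deriv_rsSuperG (w : ℝ) :
    deriv (rsSuperG κ) w = -2 * rsSuperBeta κ * w * (1 + w ^ 2) ^ (-rsSuperBeta κ - 1) :=
  (hasDerivAt_rsSuperG κ w).deriv

/-- `deriv G` as a function. [folklore] -/
theorem deriv_rsSuperG_eq :
    deriv (rsSuperG κ) = fun w ↦ -2 * rsSuperBeta κ * w * (1 + w ^ 2) ^ (-rsSuperBeta κ - 1) :=
  funext (deriv_rsSuperG κ)

/-- **Second derivative**: `G''(w) = -2β(1+w²)^{-β-1} + 4β(β+1)w²(1+w²)^{-β-2}`. [folklore] -/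
theorem hasDerivAt_deriv_rsSuperG (w : ℝ) :
    HasDerivAt (deriv (rsSuperG κ))
      (-2 * rsSuperBeta κ * (1 + w ^ 2) ^ (-rsSuperBeta κ - 1) +
        4 * rsSuperBeta κ * (rsSuperBeta κ + 1) * w ^ 2 * (1 + w ^ 2) ^ (-rsSuperBeta κ - 2)) w := by
  set β := rsSuperBeta κ with hβ
  have hfun : deriv (rsSuperG κ) = fun y ↦ -2 * β * (y * (1 + y ^ 2) ^ (-β - 1)) := by
    rw [deriv_rsSuperG_eq]
    funext y
    ring
  rw [hfun]
  have hu : HasDerivAt (fun w : ℝ ↦ 1 + w ^ 2) (2 * w) w := by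
    simpa using (hasDerivAt_pow 2 w).const_add 1
  have hp : HasDerivAt (fun y : ℝ ↦ (1 + y ^ 2) ^ (-β - 1))
      (2 * w * (-β - 1) * (1 + w ^ 2) ^ (-β - 1 - 1)) w :=
    hu.rpow_const (p := -β - 1) (Or.inl (one_add_sq_pos' w).ne')
  have h : HasDerivAt (fun y : ℝ ↦ y * (1 + y ^ 2) ^ (-β - 1))
      (1 * (1 + w ^ 2) ^ (-β - 1) + w * (2 * w * (-β - 1) * (1 + w ^ 2) ^ (-β - 1 - 1))) w :=
    (hasDerivAt_id' w).mul hp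
  refine (h.const_mul (-2 * β)).congr_deriv ?_
  have hexp : -β - 1 - 1 = -β - 2 := by ring
  have hsplit : (1 + w ^ 2) ^ (-β - 1) = (1 + w ^ 2) * (1 + w ^ 2) ^ (-β - 2) := by
    rw [show -β - 1 = 1 + (-β - 2) by ring, rpow_add (one_add_sq_pos' w), rpow_one]
  rw [hexp, hsplit]
  ring

/-- `iteratedDeriv 2 G w = -2β(1+w²)^{-β-1} + 4β(β+1)w²(1+w²)^{-β-2}`. [folklore] -/
theorem iteratedDeriv_two_rsSuperG (w : ℝ) :
    iteratedDeriv 2 (rsSuperG κ) w =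
      -2 * rsSuperBeta κ * (1 + w ^ 2) ^ (-rsSuperBeta κ - 1) +
        4 * rsSuperBeta κ * (rsSuperBeta κ + 1) * w ^ 2 * (1 + w ^ 2) ^ (-rsSuperBeta κ - 2) := by
  rw [iteratedDeriv_succ, iteratedDeriv_one]
  exact (hasDerivAt_deriv_rsSuperG κ w).deriv

/-- `G` is smooth (`1 + w² > 0`). [folklore] -/
theorem contDiff_rsSuperG {n : WithTop ℕ∞} : ContDiff ℝ n (rsSuperG κ) := by
  unfold rsSuperG
  exact contDiff_const.add
    ((contDiff_const.add (contDiff_id.pow 2)).rpow_const_of_ne fun w ↦ (one_add_sq_pos' w).ne')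

/-- `G`, viewed as a time-independent function `(t, w) ↦ G(w)`, is `C²` jointly (the regularity
hypothesis of the tree's Itô formula `ito_formula_itoProcess_ae`). [folklore] -/
theorem contDiff_uncurry_rsSuperG {n : WithTop ℕ∞} :
    ContDiff ℝ n (Function.uncurry fun (_ : ℝ) (w : ℝ) ↦ rsSuperG κ w) :=
  (contDiff_rsSuperG κ).comp contDiff_snd

end SuperG

/-! ### The generator inequality `D_G ≤ 0` -/

/-- **Rohde–Schramm's drift functional** for `M = R^a G(w)`:
`D_G(w) = 4a G(w)/(1+w²)² + 4w G'(w)/(1+w²) + (κ/2) G''(w)`, for `G = rsSuperG κ`,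
`a = rsSuperExp κ`, written with `deriv` / `iteratedDeriv 2` (the drift of `Rₜ^a G(xₜ/yₜ)` is
`(Rₜ^a/yₜ²) D_G(wₜ)`, from (6.4) `∂ₜ log Rₜ = 4yₜ²/|zₜ|⁴`, `dx = (2x/|z|²)dt - dW`,
`ẏ = -2y/|z|²`, `d⟨x⟩ = κ dt`). [cite: RohdeSchramm2005, Lemma 6.3 (proof, p. 904)] -/
def rsSuperDrift (κ w : ℝ) : ℝ :=
  4 * rsSuperExp κ * rsSuperG κ w / (1 + w ^ 2) ^ 2 +
    4 * w * deriv (rsSuperG κ) w / (1 + w ^ 2) + κ / 2 * iteratedDeriv 2 (rsSuperG κ) w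

section Drift

variable {κ : ℝ}

/-- **The drift in closed form.** With `u = 1 + w²`, `p = u^{-β}`:
`D_G(w) = (p/u²) · (4a u^β + (4a - κβ) + βw²(2κβ + κ - 8))`. [folklore] -/
theorem rsSuperDrift_eq (κ w : ℝ) :
    rsSuperDrift κ w = (1 + w ^ 2) ^ (-rsSuperBeta κ) / (1 + w ^ 2) ^ 2 *
      (4 * rsSuperExp κ * (1 + w ^ 2) ^ rsSuperBeta κ + (4 * rsSuperExp κ - κ * rsSuperBeta κ) +
        rsSuperBeta κ * w ^ 2 * (2 * κ * rsSuperBeta κ + κ - 8)) := by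
  set β := rsSuperBeta κ with hβ
  set a := rsSuperExp κ with ha
  set u := 1 + w ^ 2 with hu
  have hu0 : 0 < u := one_add_sq_pos' w
  have hp0 : 0 < u ^ (-β) := rpow_pos_of_pos hu0 _
  -- express the powers through `p = u^{-β}`
  have h1 : u ^ (-β - 1) = u ^ (-β) / u := by
    rw [rpow_sub hu0, rpow_one]
  have h2 : u ^ (-β - 2) = u ^ (-β) / u ^ 2 := by
    rw [rpow_sub hu0, rpow_two]
  have h3 : u ^ β = (u ^ (-β))⁻¹ := by
    rw [rpow_neg hu0.le, inv_inv]
  rw [rsSuperDrift, deriv_rsSuperG, iteratedDeriv_two_rsSuperG, rsSuperG_apply, ← hβ, ← ha, ← hu,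
    h1, h2, h3]
  field_simp
  ring

/-- **The generator inequality `D_G(w) ≤ 0`** for `0 ≤ κ < 8` and every real `w`: by
`rsSuperDrift_eq`, Bernoulli's inequality `(1+w²)^β ≤ 1 + βw²` (`0 ≤ β ≤ 1`), `8a = κβ` and
`4a + 2κβ + κ - 8 ≤ 0`. This is what makes `Rₜ^a (1 + (1+wₜ²)^{-β})` a non-negative local
supermartingale in the discharge of Rohde–Schramm's Lemma 6.3 (`κ < 8`). [folklore] -/
theorem rsSuperDrift_nonpos (h0 : 0 ≤ κ) (h8 : κ < 8) (w : ℝ) : rsSuperDrift κ w ≤ 0 := by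
  rw [rsSuperDrift_eq]
  set β := rsSuperBeta κ with hβ
  set a := rsSuperExp κ with ha
  have hβ0 : 0 ≤ β := rsSuperBeta_nonneg (by linarith) h8.le
  have hβ1 : β ≤ 1 := rsSuperBeta_le_one h0
  have ha0 : 0 ≤ a := rsSuperExp_nonneg h0 h8.le
  have h8a : 8 * a = κ * β := eight_mul_rsSuperExp (by linarith)
  have hineq : 4 * a + 2 * κ * β + κ - 8 ≤ 0 := rsSuper_ineq h0 h8.le
  have hu0 : 0 < 1 + w ^ 2 := one_add_sq_pos' w
  have hfac : 0 ≤ (1 + w ^ 2) ^ (-β) / (1 + w ^ 2) ^ 2 :=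
    div_nonneg (rpow_pos_of_pos hu0 _).le (by positivity)
  apply mul_nonpos_of_nonneg_of_nonpos hfac
  -- Bernoulli
  have hB : (1 + w ^ 2) ^ β ≤ 1 + β * w ^ 2 :=
    rpow_one_add_le_one_add_mul_self (by nlinarith) hβ0 hβ1
  have hw2 : 0 ≤ w ^ 2 := sq_nonneg w
  calc 4 * a * (1 + w ^ 2) ^ β + (4 * a - κ * β) + β * w ^ 2 * (2 * κ * β + κ - 8)
      ≤ 4 * a * (1 + β * w ^ 2) + (4 * a - κ * β) + β * w ^ 2 * (2 * κ * β + κ - 8) := by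
        gcongr
    _ = (8 * a - κ * β) + β * w ^ 2 * (4 * a + 2 * κ * β + κ - 8) := by ring
    _ ≤ 0 := by
        rw [h8a, sub_self, zero_add]
        exact mul_nonpos_of_nonneg_of_nonpos (mul_nonneg hβ0 hw2) hineq

/-- The supermartingale bound in the form used downstream: for `0 ≤ κ < 8`, every `R ≥ 0`, `y ≠ 0`:
`(R^a / y²) D_G(w) ≤ 0`. [folklore] -/
theorem rsSuperDrift_mul_nonpos (h0 : 0 ≤ κ) (h8 : κ < 8) {c : ℝ} (hc : 0 ≤ c) (w : ℝ) :
    c * rsSuperDrift κ w ≤ 0 :=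
  mul_nonpos_of_nonneg_of_nonpos hc (rsSuperDrift_nonpos h0 h8 w)

end Drift

end Literature.Probability.RandomPlanarGeometry
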